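import Summits.QuantumFields.YangMills.Theorems.OnsetSkewLawOnsetVanishing
import Summits.QuantumFields.YangMills.Theorems.BalabanLadderInfVolCeilingsDLR
import HarnessLib

/-!
# Crux `MarkovAtoms.OnsetFloor` (stmt-QuantumFields-22956), LINE «MarkovFloorInheritance» (planner ym-idea-11 g13,
# registered skeleton sha a13b1c2b): the registered stub `stub_uvQuietVar` — UV QUIETNESS IN BOUNDARY-OSCILLATION-VARIANCE
# CURRENCY, PROVED

For every compact simple `G`, lattice datum `r`, compactly supported profile `b`, box/collar parameters `R₀, Λ₀`, every
`ε > 0` and `S₀ > 0`: for `β ≥ β₁` every cell atom `A = Σ_x b(s(x + o_q) − y)·P_q(x)` of resolution `s ≥ S₀`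
(`y ∈ [0,s]⁴`) has boundary-oscillation variance `V = ∫ (kerE_cube(A)(η) − E_μ A)² dμ(η) < ε` in every odd-torus limit
state `μ` (the `let V` text is the crux's, verbatim).

PROOF (the planner's (A′)): (1) JENSEN for the probability kernel `kerE` — `(kerE(A)(η) − E A)² = kerE(A − E A)(η)² ≤
kerE((A − E A)²)(η)`; (2) DLR for odd-torus limit states (tree `mem_ymGibbsMeasures_of_mem_infiniteVolumeLimitPoints_holds`,
`IsGibbsMeasure.integral_integral_eq`) — `∫ kerE((A − E A)²) dμ = Var_μ(A)`; (3) the atom is a FINITE sum over one box of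
sites (`OnsetSkewLawGlue.exists_support_box_unif`), so by Cauchy–Schwarz `Var_μ(A) ≤ #S · Σ_x w_x² Var_μ(P_q(x))
≤ (#S · sup|b|)² · max_x Var_μ(P_q(x))`; (4) the variance of a single plane field in an odd-torus limit state is
`≤ 2N·(N η)` once the plaquette deficit is `≤ N η` (`integral_deficit_le`, `abs_stateMomentStr_two_le` — the volume-uniform
weak-coupling plaquette floor).  Choosing `η` small in terms of `ε, #S, sup|b|, N` gives `V < ε` for `β ≥ β₁(η)`.

The statement `StubUVQuietVarP` is copied verbatim from the skeleton (registered-stub abbrev, no tag) and closed BY NAME.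
HONEST FRAMING: the boundedness half of one stub of an OPEN crux; `stub_singleSlot`, `stub_positiveTimeSynthesisCollar`,
`stub_markovFloorInheritance` and the residual `OnsetFloorQ2` are untouched; no crux / rung / summit; the Yang–Mills mass gap
is NOT proved.  Width seat `ym-line-sfw-p2-w3` g33 (cell ym-idea-1, free hands). [cite: Georgii2011, Rem. 1.24]
-/

set_option autoImplicit false

noncomputable section

open MeasureTheory Filter Topology
open Literature.MathematicalPhysics.QuantumFieldTheory
open Literature.MathematicalPhysics.QuantumLattice hiding cubeEdges
open Literature.Probability.LatticeModels (Site IsGibbsMeasure IsSpecification)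
open Summit.QuantumFields.YangMills.Theorems.InfiniteVolume Summit.QuantumFields.YangMills.Theorems.InfVolRP
open Summit.QuantumFields.YangMills.Cruxes.OSLegsFromFemtoAndGap.DlrCollarTransfer
open Summit.QuantumFields.YangMills.Theorems.OnsetSkewLawGlue (integral_deficit_le abs_stateMomentStr_two_le
  exists_support_box_unif abs_plane_le_N)
open Summit.QuantumFields.YangMills.Theorems.OnsetTautologyOnsetContraction (stateMomentStr_two)

namespace Summit.QuantumFields.YangMills.Theorems.MarkovOnsetFloorUVQuietVar

/-- The registered stub statement `StubUVQuietVarP` of LINE «MarkovFloorInheritance» (verbatim; registered-stub copy, not a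
citable fact): UV quietness in boundary-oscillation-variance currency. -/
abbrev StubUVQuietVarP : Prop :=
  ∀ (G : Type) [Group G] [TopologicalSpace G] [IsTopologicalGroup G] [CompactSpace G],
    IsCompactSimpleLieGroup G →
    letI : MeasurableSpace G := borel G
    haveI : BorelSpace G := ⟨rfl⟩
    ∀ (r : LatticeRep G) (b : SchwartzMap (EuclideanSpace ℝ (Fin 4)) ℝ) (R₀ Λ₀ : ℝ), HasCompactSupport b →
      ∀ ε : ℝ, 0 < ε → ∀ S₀ : ℝ, 0 < S₀ → ∃ β₁ : ℝ, ∀ β : ℝ, β₁ ≤ β → ∀ μ ∈ oddTorusLimitPoints r β,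
        let V : Fin 4 × Fin 4 → ℝ → EuclideanSpace ℝ (Fin 4) → ℝ := fun q s y => ∫ η, (kerE G r β (fun j => ⌊y j / s⌋ - (⌈Λ₀ / s⌉₊ : ℕ) - 1) (⌈R₀ / s⌉₊ + 2 * ⌈Λ₀ / s⌉₊ + 4) η (fun U => ∑' x : Fin 4 → ℤ, b (s • (siteToE x + centreOffset q) - y) * plane G r q x U) - ∫ U, (∑' x : Fin 4 → ℤ, b (s • (siteToE x + centreOffset q) - y) * plane G r q x U) ∂μ) ^ 2 ∂μ ; ∀ s : ℝ, S₀ ≤ s → ∀ (q : Fin 4 × Fin 4) (y : EuclideanSpace ℝ (Fin 4)), q.1 < q.2 → (∀ i, 0 ≤ y i ∧ y i ≤ s) → V q s y < ε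

section Tools

variable {G : Type} [Group G] [TopologicalSpace G] [IsTopologicalGroup G] [CompactSpace G]
  [MeasurableSpace G] [BorelSpace G]

/-- **Jensen for a probability measure, squared mean**: `(∫ f)² ≤ ∫ f²` for a bounded measurable `f`. [folklore] -/
theorem sq_integral_le_integral_sq {X : Type*} [MeasurableSpace X] (ν : Measure X) [IsProbabilityMeasure ν]
    {f : X → ℝ} (hf : Measurable f) {C : ℝ} (hC : ∀ x, |f x| ≤ C) :
    (∫ x, f x ∂ν) ^ 2 ≤ ∫ x, f x ^ 2 ∂ν := by
  have hmem : MemLp f 2 ν := MemLp.of_bound hf.aestronglyMeasurable C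
    (Eventually.of_forall fun x => by rw [Real.norm_eq_abs]; exact hC x)
  have h := ProbabilityTheory.variance_nonneg f ν
  rw [ProbabilityTheory.variance_eq_sub hmem] at h
  simp only [Pi.pow_apply] at h
  linarith

/-- A cell atom with finitely supported weights is a finite sum: if the weight vanishes off `T` then
`∑' x, w x · P_x = Σ_{x ∈ T} w x · P_x`. [folklore] -/
theorem tsum_weights_eq_sum {w : Site 4 → ℝ} {T : Finset (Site 4)} (hw : ∀ x, x ∉ T → w x = 0)
    (P : Site 4 → ℝ) : ∑' x, w x * P x = ∑ x ∈ T, w x * P x :=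
  tsum_eq_sum fun x hx => by rw [hw x hx, zero_mul]

end Tools

/-- **`stub_uvQuietVar` of LINE «MarkovFloorInheritance», BY NAME.** [cite: Georgii2011, Rem. 1.24] -/
theorem stub_uvQuietVar : StubUVQuietVarP := by
  intro G _ _ _ _ _hG r b R₀ Λ₀ hb ε hε S₀ hS₀
  letI : MeasurableSpace G := borel G
  haveI : BorelSpace G := ⟨rfl⟩
  haveI : SecondCountableTopology G := r.secondCountableTopology
  haveI : T2Space G := r.t2Space
  -- the profile is bounded
  obtain ⟨Mb, hMb⟩ : ∃ M : ℝ, ∀ u, |b u| ≤ M :=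
    ⟨‖b.toBoundedContinuousFunction‖, fun u => by
      have h := BoundedContinuousFunction.norm_coe_le_norm b.toBoundedContinuousFunction u
      rwa [SchwartzMap.toBoundedContinuousFunction_apply, Real.norm_eq_abs] at h⟩
  have hMb0 : 0 ≤ Mb := (abs_nonneg _).trans (hMb 0)
  -- ONE finite box of sites carries every atom of resolution `s ≥ S₀` positioned in `[0,s]⁴`
  obtain ⟨S, hS⟩ := exists_support_box_unif (b : EuclideanSpace ℝ (Fin 4) → ℝ) hb Finset.univ hS₀
  set T : Finset (Site 4) := S.image Prod.snd with hT
  -- the single-plane bound `N`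
  have hN := abs_plane_le_N (G := G) r
  -- the deficit scale `η` and the threshold
  set D : ℝ := ((T.card : ℝ) * Mb) ^ 2 * (2 * (r.N : ℝ) * (r.N : ℝ)) + 1 with hD
  have hDpos : 0 < D := by positivity
  set η : ℝ := ε / (2 * D) with hη
  have hηpos : 0 < η := by positivity
  obtain ⟨β₀, hβ₀⟩ := integral_deficit_le (G := G) r hηpos
  refine ⟨β₀, fun β hβ μ hμ => ?_⟩
  intro V s hs q y hq hy
  -- the state: probability, DLR
  have hμinf := mem_infiniteVolumeLimitPoints_of_mem_oddTorusLimitPoints r hμ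
  have hprob : IsProbabilityMeasure μ := by obtain ⟨-, -, hp, -⟩ := id hμinf; exact hp
  have hγ : IsSpecification (ymSpecification (d := 4) r.ρ β) := isSpecification_ymSpecification_of_t2Space r.ρ r.continuous β
  have hG : IsGibbsMeasure (ymSpecification (d := 4) r.ρ β) μ :=
    (mem_ymGibbsMeasures_iff r.ρ β μ).mp
      (mem_ymGibbsMeasures_of_mem_infiniteVolumeLimitPoints_holds (d := 4) r.ρ r.continuous hμinf)
  -- the weights and their support
  set w : Site 4 → ℝ := fun x => b (s • (siteToE x + centreOffset q) - y) with hw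
  have hwT : ∀ x, x ∉ T → w x = 0 := by
    intro x hx
    have hmem : (q, x) ∉ S := fun h => hx (Finset.mem_image.2 ⟨(q, x), h, rfl⟩)
    have h := (hS s hs y hy (q, x) hmem).1
    simp only [Finset.mem_univ, true_and, hq, ↓reduceIte] at h
    exact h
  have hwb : ∀ x, |w x| ≤ Mb := fun x => hMb _
  -- the atom as a finite sum
  set A : LGConfig 4 G → ℝ := fun U => ∑' x : Fin 4 → ℤ, b (s • (siteToE x + centreOffset q) - y) * plane G r q x U
    with hA
  have hAeq : ∀ U, A U = ∑ x ∈ T, w x * plane G r q x U := fun U => tsum_weights_eq_sum hwT _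
  have hAc : Continuous A := by
    have : A = fun U => ∑ x ∈ T, w x * plane G r q x U := funext hAeq
    rw [this]
    exact continuous_finsetSum T fun x _ => continuous_const.mul (continuous_plane r q x)
  have hAb : ∀ U, |A U| ≤ T.card * Mb * r.N := by
    intro U
    rw [hAeq]
    calc |∑ x ∈ T, w x * plane G r q x U| ≤ ∑ x ∈ T, |w x * plane G r q x U| := Finset.abs_sum_le_sum_abs _ _
      _ ≤ ∑ _x ∈ T, Mb * r.N := Finset.sum_le_sum fun x _ => by
          rw [abs_mul]; exact mul_le_mul (hwb x) (hN q x U) (abs_nonneg _) hMb0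
      _ = T.card * Mb * r.N := by rw [Finset.sum_const, nsmul_eq_mul]; ring
  have hAm : Measurable A := hAc.measurable
  set m : ℝ := ∫ U, A U ∂μ with hm
  -- the centred atom
  have hAmc : Continuous fun U => (A U - m) ^ 2 := (hAc.sub continuous_const).pow 2
  have hAmb : ∀ U, |(A U - m) ^ 2| ≤ (2 * (T.card * Mb * r.N)) ^ 2 := by
    intro U
    have hmle : |m| ≤ T.card * Mb * r.N := abs_integral_le_of_abs_le hAb
    rw [abs_pow]
    refine pow_le_pow_left₀ (abs_nonneg _) ?_ 2
    calc |A U - m| ≤ |A U| + |m| := abs_sub _ _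
      _ ≤ _ := by linarith [hAb U]
  -- (1)+(2): Jensen for the kernel and DLR ⇒ `V ≤ Var_μ(A)`
  set Λ := cubeEdges (fun j => ⌊y j / s⌋ - (⌈Λ₀ / s⌉₊ : ℕ) - 1) (⌈R₀ / s⌉₊ + 2 * ⌈Λ₀ / s⌉₊ + 4) with hΛ
  have hker_prob : ∀ η' : LGConfig 4 G, IsProbabilityMeasure (ymSpecification r.ρ β Λ η') :=
    isProbabilityMeasure_ymSpecification r.ρ r.continuous β Λ
  have hJensen : ∀ η' : LGConfig 4 G,
      (kerE G r β (fun j => ⌊y j / s⌋ - (⌈Λ₀ / s⌉₊ : ℕ) - 1) (⌈R₀ / s⌉₊ + 2 * ⌈Λ₀ / s⌉₊ + 4) η' A - m) ^ 2 ≤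
        ∫ U, (A U - m) ^ 2 ∂(ymSpecification r.ρ β Λ η') := by
    intro η'
    haveI := hker_prob η'
    have e : kerE G r β (fun j => ⌊y j / s⌋ - (⌈Λ₀ / s⌉₊ : ℕ) - 1) (⌈R₀ / s⌉₊ + 2 * ⌈Λ₀ / s⌉₊ + 4) η' A - m =
        ∫ U, (A U - m) ∂(ymSpecification r.ρ β Λ η') := by
      unfold kerE
      rw [integral_sub_const_of_abs_le hAm hAb m]
    rw [e]
    exact sq_integral_le_integral_sq _ (hAm.sub measurable_const) (C := 2 * (T.card * Mb * r.N)) fun U => by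
      have hmle : |m| ≤ T.card * Mb * r.N := abs_integral_le_of_abs_le hAb
      calc |A U - m| ≤ |A U| + |m| := abs_sub _ _
        _ ≤ _ := by linarith [hAb U]
  have hKc : Continuous fun η' : LGConfig 4 G => ∫ U, (A U - m) ^ 2 ∂(ymSpecification r.ρ β Λ η') :=
    continuous_integral_ymSpecification r.ρ r.continuous β Λ hAmc hAmb
  have hKb : ∀ η', |∫ U, (A U - m) ^ 2 ∂(ymSpecification r.ρ β Λ η')| ≤ (2 * (T.card * Mb * r.N)) ^ 2 := fun η' =>
    abs_integral_ymSpecification_le r.ρ r.continuous β Λ hAmb η'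
  have hVle : ∫ η', (kerE G r β (fun j => ⌊y j / s⌋ - (⌈Λ₀ / s⌉₊ : ℕ) - 1) (⌈R₀ / s⌉₊ + 2 * ⌈Λ₀ / s⌉₊ + 4) η' A - m) ^ 2 ∂μ
      ≤ ∫ U, (A U - m) ^ 2 ∂μ := by
    have hint2 : Integrable (fun η' : LGConfig 4 G => ∫ U, (A U - m) ^ 2 ∂(ymSpecification r.ρ β Λ η')) μ :=
      integrable_of_abs_le hKc.measurable hKb
    calc ∫ η', (kerE G r β (fun j => ⌊y j / s⌋ - (⌈Λ₀ / s⌉₊ : ℕ) - 1) (⌈R₀ / s⌉₊ + 2 * ⌈Λ₀ / s⌉₊ + 4) η' A - m) ^ 2 ∂μ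
        ≤ ∫ η', (∫ U, (A U - m) ^ 2 ∂(ymSpecification r.ρ β Λ η')) ∂μ :=
          integral_mono_of_nonneg (Eventually.of_forall fun _ => sq_nonneg _) hint2
            (Eventually.of_forall hJensen)
      _ = ∫ U, (A U - m) ^ 2 ∂μ :=
          hG.integral_integral_eq hγ Λ (integrable_of_abs_le hAmc.measurable hAmb)
  -- (3): the variance of the finite atom by Cauchy–Schwarz over the box
  have hmsum : m = ∑ x ∈ T, w x * ∫ V', plane G r q x V' ∂μ := by
    rw [hm]
    have : (fun U => A U) = fun U => ∑ x ∈ T, w x * plane G r q x U := funext hAeq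
    rw [this, integral_finsetSum T fun x _ => ?_]
    · refine Finset.sum_congr rfl fun x _ => ?_
      rw [integral_const_mul]
    · exact (integrable_of_abs_le (continuous_plane r q x).measurable (fun U => hN q x U)).const_mul _
  have hptwise : ∀ U, (A U - m) ^ 2 ≤ T.card * ∑ x ∈ T, (w x) ^ 2 * (plane G r q x U - ∫ V', plane G r q x V' ∂μ) ^ 2 := by
    intro U
    have e : A U - m = ∑ x ∈ T, w x * (plane G r q x U - ∫ V', plane G r q x V' ∂μ) := by
      rw [hAeq, hmsum, ← Finset.sum_sub_distrib]
      exact Finset.sum_congr rfl fun x _ => by ring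
    rw [e]
    calc (∑ x ∈ T, w x * (plane G r q x U - ∫ V', plane G r q x V' ∂μ)) ^ 2
        ≤ T.card * ∑ x ∈ T, (w x * (plane G r q x U - ∫ V', plane G r q x V' ∂μ)) ^ 2 := sq_sum_le_card_mul_sum_sq
      _ = T.card * ∑ x ∈ T, (w x) ^ 2 * (plane G r q x U - ∫ V', plane G r q x V' ∂μ) ^ 2 := by
          congr 1; exact Finset.sum_congr rfl fun x _ => by ring
  -- (4): the single-plane variances
  have hdef : ∀ x : Site 4, ∫ U, ((r.N : ℝ) - plane G r q x U) ∂μ ≤ r.N * η := fun x => hβ₀ β hβ μ hμ q hq x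
  have hvar : ∀ x : Site 4, ∫ U, (plane G r q x U - ∫ V', plane G r q x V' ∂μ) ^ 2 ∂μ ≤ 2 * r.N * (r.N * η) := by
    intro x
    have h := abs_stateMomentStr_two_le (G := G) r μ q q x x (hdef x) (hdef x)
    rw [stateMomentStr_two] at h
    have e : (fun U => (plane G r q x U - ∫ V', plane G r q x V' ∂μ) ^ 2) =
        fun U => (plane G r q x U - ∫ V', plane G r q x V' ∂μ) * (plane G r q x U - ∫ V', plane G r q x V' ∂μ) := by
      funext U; ring
    rw [e]
    exact (le_abs_self _).trans h
  have hplane_c : ∀ x : Site 4, Continuous fun U => (plane G r q x U - ∫ V', plane G r q x V' ∂μ) ^ 2 := fun x =>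
    ((continuous_plane r q x).sub continuous_const).pow 2
  have hplane_b : ∀ (x : Site 4) U, |(plane G r q x U - ∫ V', plane G r q x V' ∂μ) ^ 2| ≤ (2 * r.N) ^ 2 := by
    intro x U
    have hmle : |∫ V', plane G r q x V' ∂μ| ≤ r.N := abs_integral_le_of_abs_le fun U => hN q x U
    rw [abs_pow]
    refine pow_le_pow_left₀ (abs_nonneg _) ?_ 2
    calc |plane G r q x U - ∫ V', plane G r q x V' ∂μ| ≤ |plane G r q x U| + |∫ V', plane G r q x V' ∂μ| := abs_sub _ _
      _ ≤ r.N + r.N := add_le_add (hN q x U) hmle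
      _ = 2 * r.N := by ring
  have hVar : ∫ U, (A U - m) ^ 2 ∂μ ≤ ((T.card : ℝ) * Mb) ^ 2 * (2 * r.N * (r.N * η)) := by
    have hint_rhs : Integrable (fun U => (T.card : ℝ) * ∑ x ∈ T, (w x) ^ 2 *
        (plane G r q x U - ∫ V', plane G r q x V' ∂μ) ^ 2) μ := by
      refine (integrable_finsetSum T fun x _ => ?_).const_mul _
      exact (integrable_of_abs_le (hplane_c x).measurable (hplane_b x)).const_mul _
    calc ∫ U, (A U - m) ^ 2 ∂μ
        ≤ ∫ U, (T.card : ℝ) * ∑ x ∈ T, (w x) ^ 2 * (plane G r q x U - ∫ V', plane G r q x V' ∂μ) ^ 2 ∂μ :=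
          integral_mono_of_nonneg (Eventually.of_forall fun _ => sq_nonneg _) hint_rhs (Eventually.of_forall hptwise)
      _ = (T.card : ℝ) * ∑ x ∈ T, (w x) ^ 2 * ∫ U, (plane G r q x U - ∫ V', plane G r q x V' ∂μ) ^ 2 ∂μ := by
          rw [integral_const_mul, integral_finsetSum T fun x _ =>
            (integrable_of_abs_le (hplane_c x).measurable (hplane_b x)).const_mul _]
          congr 1
          exact Finset.sum_congr rfl fun x _ => integral_const_mul _ _
      _ ≤ (T.card : ℝ) * ∑ _x ∈ T, Mb ^ 2 * (2 * r.N * (r.N * η)) := by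
          refine mul_le_mul_of_nonneg_left (Finset.sum_le_sum fun x _ => ?_) (Nat.cast_nonneg _)
          have hw2 : (w x) ^ 2 ≤ Mb ^ 2 := by
            rw [← sq_abs]; exact pow_le_pow_left₀ (abs_nonneg _) (hwb x) 2
          exact mul_le_mul hw2 (hvar x) (integral_nonneg fun U => sq_nonneg _) (sq_nonneg _)
      _ = ((T.card : ℝ) * Mb) ^ 2 * (2 * r.N * (r.N * η)) := by
          rw [Finset.sum_const, nsmul_eq_mul]; ring
  -- conclusion
  show ∫ η', (kerE G r β (fun j => ⌊y j / s⌋ - (⌈Λ₀ / s⌉₊ : ℕ) - 1) (⌈R₀ / s⌉₊ + 2 * ⌈Λ₀ / s⌉₊ + 4) η' A -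
      ∫ U, A U ∂μ) ^ 2 ∂μ < ε
  rw [← hm]
  have hfin : ((T.card : ℝ) * Mb) ^ 2 * (2 * r.N * (r.N * η)) < ε := by
    have e : ((T.card : ℝ) * Mb) ^ 2 * (2 * r.N * (r.N * η)) = (((T.card : ℝ) * Mb) ^ 2 * (2 * (r.N : ℝ) * r.N)) * η := by
      ring
    rw [e, hη]
    have hle : ((T.card : ℝ) * Mb) ^ 2 * (2 * (r.N : ℝ) * r.N) ≤ D := by rw [hD]; linarith
    calc ((T.card : ℝ) * Mb) ^ 2 * (2 * (r.N : ℝ) * r.N) * (ε / (2 * D)) ≤ D * (ε / (2 * D)) :=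
          mul_le_mul_of_nonneg_right hle (by positivity)
      _ = ε / 2 := by field_simp
      _ < ε := by linarith
  exact (hVle.trans hVar).trans_lt hfin

end Summit.QuantumFields.YangMills.Theorems.MarkovOnsetFloorUVQuietVar

end
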